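import Summits.HodgeConjecture.HodgeCM.PerL34.FockBargmannKernel_1

/-! PORT of `HodgeCM/PerL34/FockBargmannKernel.lean` (HodgeCMPerL run 82) — part 2: continuation of `Summits.HodgeConjecture.HodgeCM.PerL34.FockBargmannKernel_1` (split at a top-level declaration boundary by port_pkg.py; scope re-opened below; declarations unchanged). -/

-- port_pkg: scope re-opened for this part (file-level context, then the namespace/section stack open at the cut)
set_option autoImplicit false
open MvPolynomial Complex MeasureTheory Filter
open scoped Real InnerProductSpace Topology
namespace HodgeCM.PerL34.Fock.Hermite
noncomputable section
section NDim
variable {σ : Type*} [Fintype σ] [DecidableEq σ]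
omit [DecidableEq σ] in
/-- **`B h_0 = 1`** ([Fo89 (1.64)]: the Gaussian integral `2^{n/4} ∫ 2^{n/4}e^{−πx²} e^{2πxz−πx²−(π/2)z²} dx = 1`). -/
theorem bargmannFun_vac (z : σ → ℂ) : bargmannFun (hermiteFun (vac σ)) z = 1 := by
  rw [bargmannFun_hermiteFun, vac, show (C (vacCoef σ : ℂ) : MvPolynomial σ ℂ) = (vacCoef σ : ℂ) • monomial 0 1 by
    rw [← monomial_eq_smul]; rfl, map_smul, gintz_monomial]
  simp_rw [Finsupp.coe_zero, Pi.zero_apply, integral_gmz_zero]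
  rw [Finset.prod_mul_distrib, Finset.prod_const, Finset.card_univ, ← Complex.exp_sum, smul_eq_mul]
  have hsum : ∑ k, ((2 * π : ℂ) * z k) ^ 2 / (8 * π) = (π / 2 : ℂ) * ∑ k, z k ^ 2 := by
    rw [Finset.mul_sum]
    refine Finset.sum_congr rfl fun k _ => ?_
    have hπ : (π : ℂ) ≠ 0 := pi_ne_zero'
    field_simp
    ring
  rw [hsum]
  have hexp : cexp (-(π / 2 : ℂ) * ∑ k, z k ^ 2) * cexp ((π / 2 : ℂ) * ∑ k, z k ^ 2) = 1 := by
    rw [← Complex.exp_add, show -(π / 2 : ℂ) * ∑ k, z k ^ 2 + (π / 2 : ℂ) * ∑ k, z k ^ 2 = 0 by ring, Complex.exp_zero]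
  have hconst : (vacCoef σ : ℝ) * ((vacCoef σ : ℝ) * ((Real.sqrt 2)⁻¹) ^ Fintype.card σ) = 1 := by
    rw [vacCoef, ← mul_assoc, ← Real.rpow_add two_pos, Real.sqrt_eq_rpow, ← Real.rpow_neg_one, ← Real.rpow_mul (by norm_num),
      ← Real.rpow_natCast, ← Real.rpow_mul (by norm_num), ← Real.rpow_add two_pos]
    rw [show (Fintype.card σ : ℝ) / 4 + (Fintype.card σ : ℝ) / 4 + 1 / 2 * -1 * (Fintype.card σ : ℝ) = 0 by ring,
      Real.rpow_zero]
  calc (vacCoef σ : ℂ) * cexp (-(π / 2 : ℂ) * ∑ k, z k ^ 2) *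
        ((vacCoef σ : ℂ) * ((((Real.sqrt 2)⁻¹ : ℝ) : ℂ) ^ Fintype.card σ * cexp ((π / 2 : ℂ) * ∑ k, z k ^ 2)))
      = (((vacCoef σ : ℝ) * ((vacCoef σ : ℝ) * ((Real.sqrt 2)⁻¹) ^ Fintype.card σ) : ℝ) : ℂ) *
          (cexp (-(π / 2 : ℂ) * ∑ k, z k ^ 2) * cexp ((π / 2 : ℂ) * ∑ k, z k ^ 2)) := by push_cast; ring
    _ = 1 := by rw [hconst, hexp]; simp

/-- **`B(F(Z^*) h_0)(z) = F(z)`** for every polynomial `F` ([Fo89 (1.64)/(1.78)]): induction over `F` using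
`B h_0 = 1` and `B Z_j^* = z_j B`. -/
theorem bargmannFun_binv (F : MvPolynomial σ ℂ) (z : σ → ℂ) :
    bargmannFun (hermiteFun (binv F)) z = eval z F := by
  induction F using MvPolynomial.induction_on with
  | C a =>
      rw [binv_C, bargmannFun_hermiteFun, map_smul, smul_eq_mul, eval_C]
      have h := bargmannFun_vac (σ := σ) z
      rw [bargmannFun_hermiteFun] at h
      linear_combination a * h
  | add F G hF hG =>
      rw [map_add, bargmannFun_hermiteFun, map_add, mul_add, ← bargmannFun_hermiteFun, ← bargmannFun_hermiteFun, hF, hG,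
        map_add]
  | mul_X F j hF =>
      rw [mul_comm, binv_X_mul, bargmannFun_opZs, hF, map_mul, eval_X, mul_comm]

/-- The `L²(ℂ^σ)`-avatar identity on the core: `F(z) e^{−(π/2)|z|²} = e^{−(π/2)|z|²} · B(F(Z^*)h_0)(z)`. -/
theorem fockFun_eq_bargmannFun (F : MvPolynomial σ ℂ) (z : σ → ℂ) :
    fockFun F z = ((fockWeight z : ℝ) : ℂ) * bargmannFun (hermiteFun (binv F)) z := by
  rw [bargmannFun_binv, fockFun, mul_comm]

end NDim

/-! ### Extension from the core to all of `L²(ℝ^σ)` -/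

section L2

variable {σ : Type*} [Fintype σ] [DecidableEq σ]

omit [DecidableEq σ] in
/-- (Ported verbatim from the HodgeCMPerL package; no docstring in the source.) -/
theorem re_bkerExponent (z : σ → ℂ) (x : σ → ℝ) :
    (∑ k, (-(π : ℂ) * (x k : ℂ) ^ 2 + (2 * π : ℂ) * z k * (x k : ℂ))).re =
      -π * ∑ k, x k ^ 2 + ∑ k, 2 * π * (z k).re * x k := by
  rw [Complex.re_sum, Finset.mul_sum, ← Finset.sum_add_distrib]
  refine Finset.sum_congr rfl fun k _ => ?_
  have e1 : (-(π : ℂ) * (x k : ℂ) ^ 2).re = -π * x k ^ 2 := by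
    rw [← Complex.ofReal_pow, ← Complex.ofReal_neg, ← Complex.ofReal_mul, Complex.ofReal_re]
  have e2 : ((2 * π : ℂ) * z k * (x k : ℂ)).re = 2 * π * (z k).re * x k := by
    rw [Complex.mul_re, Complex.ofReal_re, Complex.ofReal_im, mul_zero, sub_zero, Complex.mul_re,
      show (2 * π : ℂ) = ((2 * π : ℝ) : ℂ) by push_cast; rfl, Complex.ofReal_re, Complex.ofReal_im, zero_mul, sub_zero]
  rw [Complex.add_re, e1, e2]

omit [DecidableEq σ] in
/-- `|e^{2πx·z − π|x|²}| = e^{−π|x|² + 2π x·Re z}`. -/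
theorem norm_bkerCore (z : σ → ℂ) (x : σ → ℝ) :
    ‖bkerCore z x‖ = Real.exp (-π * ∑ k, x k ^ 2 + ∑ k, 2 * π * (z k).re * x k) := by
  rw [bkerCore, Complex.norm_exp, re_bkerExponent]

omit [DecidableEq σ] in
/-- For fixed `z`, the kernel `x ↦ e^{2πx·z − π|x|²}` is square integrable. -/
theorem memLp_bkerCore (z : σ → ℂ) : MemLp (bkerCore z) 2 (volume : Measure (σ → ℝ)) :=
  (memLp_two_exp_quadratic (fun k => 2 * π * (z k).re)).of_le (continuous_bkerCore z).aestronglyMeasurable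
    (Eventually.of_forall fun x => by
      rw [norm_bkerCore, Real.norm_eq_abs, abs_of_pos (Real.exp_pos _)])

omit [DecidableEq σ] in
/-- (Ported verbatim from the HodgeCMPerL package; no docstring in the source.) -/
theorem memLp_conj_bkerCore (z : σ → ℂ) :
    MemLp (fun x => starRingEnd ℂ (bkerCore z x)) 2 (volume : Measure (σ → ℝ)) :=
  (memLp_bkerCore z).of_le (Complex.continuous_conj.comp (continuous_bkerCore z)).aestronglyMeasurable
    (Eventually.of_forall fun x => by rw [Complex.norm_conj])

omit [DecidableEq σ] in
/-- The conjugate kernel as an element of `L²(ℝ^σ)`. -/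
def bkerL2 (z : σ → ℂ) : Lp ℂ 2 (volume : Measure (σ → ℝ)) := (memLp_conj_bkerCore z).toLp _

omit [DecidableEq σ] in
/-- (Ported verbatim from the HodgeCMPerL package; no docstring in the source.) -/
theorem bkerL2_coeFn (z : σ → ℂ) : ⇑(bkerL2 z) =ᵐ[volume] fun x => starRingEnd ℂ (bkerCore z x) :=
  MemLp.coeFn_toLp _

omit [DecidableEq σ] in
/-- `∫ f(x) e^{2πx·z−π|x|²} dx = ⟨K_z, f⟩_{L²}`: for fixed `z`, `f ↦ Bf(z)` is a bounded functional on `L²(ℝ^σ)`. -/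
theorem integral_mul_bkerCore_eq_inner (f : Lp ℂ 2 (volume : Measure (σ → ℝ))) (z : σ → ℂ) :
    ∫ x, f x * bkerCore z x = ⟪bkerL2 z, f⟫_ℂ := by
  rw [MeasureTheory.L2.inner_def]
  refine integral_congr_ae ?_
  filter_upwards [bkerL2_coeFn z] with x hx
  rw [RCLike.inner_apply, hx, Complex.conj_conj]

omit [DecidableEq σ] in
/-- (Ported verbatim from the HodgeCMPerL package; no docstring in the source.) -/
theorem bargmannFun_eq_inner (f : Lp ℂ 2 (volume : Measure (σ → ℝ))) (z : σ → ℂ) :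
    bargmannFun f z = (vacCoef σ : ℂ) * cexp (-(π / 2 : ℂ) * ∑ k, z k ^ 2) * ⟪bkerL2 z, f⟫_ℂ := by
  rw [bargmannFun, integral_mul_bkerCore_eq_inner]

omit [DecidableEq σ] in
/-- For fixed `z`, `f ↦ Bf(z)` is continuous on `L²(ℝ^σ)`. -/
theorem continuous_bargmannFun (z : σ → ℂ) :
    Continuous fun f : Lp ℂ 2 (volume : Measure (σ → ℝ)) => bargmannFun f z := by
  have h : (fun f : Lp ℂ 2 (volume : Measure (σ → ℝ)) => bargmannFun f z) =
      fun f => (vacCoef σ : ℂ) * cexp (-(π / 2 : ℂ) * ∑ k, z k ^ 2) * ⟪bkerL2 z, f⟫_ℂ :=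
    funext fun f => bargmannFun_eq_inner f z
  rw [h]
  exact continuous_const.mul (continuous_const.inner continuous_id)

/-- On the core: the unitary `bargmann` IS Folland's integral transform (times the transport weight). -/
theorem bargmann_hermToL2_coeFn (p : MvPolynomial σ ℂ) :
    ⇑(((bargmann (hermToL2 p) : FockL2 σ)) : Lp ℂ 2 (volume : Measure (σ → ℂ))) =ᵐ[volume]
      fun z => ((fockWeight z : ℝ) : ℂ) * bargmannFun (hermToL2 p) z := by
  obtain ⟨F, rfl⟩ := binv_surjective p
  rw [bargmann_hermToL2_binv]
  filter_upwards [fockToL2_coeFn F] with z hz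
  rw [hz, fockFun_eq_bargmannFun, bargmannFun_congr_ae (hermToL2_coeFn (binv F)) z]

/-- **The Bargmann transform formula on all of `L²(ℝ^σ)`** ([Fo89 §1.6, chunk p0037 L13–L20 with (1.63)–(1.64)]):
for EVERY `f ∈ L²(ℝ^σ)`, the unitary `bargmann` (defined by `h_α ↦ ζ_α`) is represented a.e. by Folland's integral:
`(bargmann f)(z) = e^{−(π/2)|z|²} · 2^{n/4} ∫ f(x) e^{2πx·z − πx² − (π/2)z²} dx`. -/
theorem bargmann_coeFn (f : Lp ℂ 2 (volume : Measure (σ → ℝ))) :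
    ⇑(((bargmann f : FockL2 σ)) : Lp ℂ 2 (volume : Measure (σ → ℂ))) =ᵐ[volume]
      fun z => ((fockWeight z : ℝ) : ℂ) * bargmannFun f z := by
  -- the transported unitary, as a continuous map into `L²(ℂ^σ)`
  set T : Lp ℂ 2 (volume : Measure (σ → ℝ)) → Lp ℂ 2 (volume : Measure (σ → ℂ)) :=
    fun g => ((bargmann g : FockL2 σ) : Lp ℂ 2 (volume : Measure (σ → ℂ))) with hT_def
  have hT : Continuous T := continuous_subtype_val.comp bargmann.continuous
  -- a sequence of core functions `p_n e^{−π|x|²}` converging to `f` in `L²`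
  have hmem : f ∈ closure ((LinearMap.range (hermToL2 (σ := σ)) : Set (Lp ℂ 2 (volume : Measure (σ → ℝ))))) := by
    rw [← Submodule.topologicalClosure_coe, hermToL2_denseRange]
    trivial
  obtain ⟨u, hu_mem, hu_tend⟩ := mem_closure_iff_seq_limit.mp hmem
  have h1 : Tendsto (fun n => T (u n)) atTop (𝓝 (T f)) := (hT.tendsto f).comp hu_tend
  -- an a.e.-convergent subsequence
  obtain ⟨ns, hns, hlim⟩ := (tendstoInMeasure_of_tendsto_Lp h1).exists_seq_tendsto_ae
  have h3 : ∀ n, ⇑(T (u n)) =ᵐ[volume] fun z => ((fockWeight z : ℝ) : ℂ) * bargmannFun (u n) z := fun n => by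
    obtain ⟨p, hp⟩ := LinearMap.mem_range.mp (hu_mem n)
    rw [← hp]
    exact bargmann_hermToL2_coeFn p
  have h4 : ∀ᵐ z ∂(volume : Measure (σ → ℂ)), ∀ n, (T (u n)) z = ((fockWeight z : ℝ) : ℂ) * bargmannFun (u n) z :=
    ae_all_iff.mpr h3
  filter_upwards [hlim, h4] with z hzlim hz4
  have h5 : Tendsto (fun i => ((fockWeight z : ℝ) : ℂ) * bargmannFun (u (ns i)) z) atTop
      (𝓝 (((fockWeight z : ℝ) : ℂ) * bargmannFun f z)) := by
    have hc : Continuous fun g : Lp ℂ 2 (volume : Measure (σ → ℝ)) => ((fockWeight z : ℝ) : ℂ) * bargmannFun g z :=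
      continuous_const.mul (continuous_bargmannFun z)
    exact (hc.tendsto f).comp (hu_tend.comp hns.tendsto_atTop)
  have h6 : (fun i => (T (u (ns i))) z) = fun i => ((fockWeight z : ℝ) : ℂ) * bargmannFun (u (ns i)) z :=
    funext fun i => hz4 (ns i)
  rw [h6] at hzlim
  exact tendsto_nhds_unique hzlim h5

end L2

end

end HodgeCM.PerL34.Fock.Hermite
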